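import Summits.KontsevichZagierPeriods.Zeta5Search.Barrier.ConeGammaCrossings

/-!
# ζ(5) search — BARRIER: WALL ORIENTATION — the torus saving is monotone in every wall (oriented Lipschitz bound)

HONEST FRAMING (cell `pub-zeta5`): systematic search; no irrationality claim unless kernel-certified. MODEL objects
under Brown–Zudilin's (28)+(30) accounting ([BZ22] = arXiv:2210.03391; (28) observed, not proved); nothing here is a
statement about `ζ(5)`, about any `γ` of record, about the cone's supremum (C2 = `BarrierC2` OPEN) or about the lemma
S-E (CONJECTURED); records in print UNMOVED. Prover P2 g26 (item «wall orientation» = P2 g25's successor menu (d)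
«is `D_b ∈ {−1,0,+1}` a theorem?», desk first; plan INBOX 2026-08-27).

THE FACT. Every torus term is `T_σ(θ) = Σ_{i∈F} (⌊φ_i θ⌋ − ⌊φ_i(σθ)⌋) = Σ_k ⌊φ_k θ⌋·([k ∈ F] − [k ∈ π_σ F])` in the 28
integer parts, so its coefficient on the floor of form `k` lies in `{0, +1}` when `k ∈ F` (`FIdx`, BZ's (27)) and in
`{−1, 0}` when `k ∉ F` — UNIFORMLY in `σ`. Hence the saving `𝒩 = max_σ T_σ` obeys an ORIENTED Lipschitz bound:
* **`torusTerm_sub_le_oriented`**, **`torusN_sub_le_oriented`**, **`oriented_le_torusN_sub`** — for all `θ₁, θ₂ ∈ ℝ⁸`,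
  with `d_k = ⌊φ_k θ₂⌋ − ⌊φ_k θ₁⌋`:
  `−(Σ_{k∈F} d_k⁻ + Σ_{k∉F} d_k⁺) ≤ 𝒩(θ₂) − 𝒩(θ₁) ≤ Σ_{k∈F} d_k⁺ + Σ_{k∉F} d_k⁻` —
  only FAVOURABLE unit moves (an `F`-floor going up, an `F^c`-floor going down) can raise the saving, each by at most
  one, and only unfavourable ones can lower it (refines the tree's `abs_torusN_sub_le_sum_abs_floor_sub`, the plain
  1-Lipschitz bound `Σ_k |d_k|`). Proof WITHOUT the induced permutation of the 28 forms: the 11-term complement form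
  `T_σ(θ₂) − T_σ(θ₁) = Σ_{i∉F} (e_i − d_i)` (`e` = the increments at `σθ`) and the `S₇`-invariance of the full sums
  `Σ_k e_k = Σ_k d_k`, `Σ_k e_k⁺ = Σ_k d_k⁺` (`sum_univ_phiForm_permS₂`); the lower bound is the upper one with
  `θ₁ ↔ θ₂` (`oriented_core` is the bookkeeping).
* **`torusN_mono_of_floors`** — 𝒩 IS MONOTONE IN EVERY WALL: `F`-floors weakly up and `F^c`-floors weakly down ⇒
  `𝒩(θ₁) ≤ 𝒩(θ₂)`; **`torusN_floor_step`** — one floor up by one, the rest equal ⇒ `𝒩` moves by a step in `{0,+1}`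
  (`k ∈ F`) resp. `{−1,0}` (`k ∉ F`).
* Along an orbit `u ↦ u·s(a)` (all 28 forms positive) at a breakpoint `b ∈ bkpts a T`: `floor_phiForm_bkpt_add`
  (the floors of `θ_b + Δ` for `Δ` below the wall distance: member forms `z` / `z − 1` by sign, non-members frozen),
  **`torusN_jump_oriented`** / **`savingN_jump_oriented`** — the JUMP of `N_a` across `b` lies between
  `−#(F^c-walls met at b)` and `+#(F-walls met at b)` (for any finsets covering those members), and
  `savingN_jump_single_wall` — a single `F`-wall is an up-step `∈ {0,1}`, a single `F^c`-wall a down-step `∈ {−1,0}`.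
DESK (DATA, `HOME/pub-zeta5-p2/g26/alg/orient.py`, exact on P2 g11's `se2.py`): 0 violations on 31,320 single-floor
steps and at all 3,754 junctions of record/41, flag/60, argmax-120, t*/480; single-wall jumps: record 12 `F`-walls
(6 up / 6 flat), flag 32 `F` (14 / 18), argmax 200 `F` (72 / 128) + 68 `F^c` (34 down / 34 flat), t* 1,056 `F` (380 /
676) + 552 `F^c` (261 / 291). The companion `ConeGammaCuspSymmetricDefectBound` draws the consequence for the
reflection defects of `ConeGammaCuspSymmetricWalls` (`|D_b(x)| ≤ min(#neg, #pos)`; `D_b ∈ {−1,0,+1}` at every two-wall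
junction). NOT here (honest): the sign of any jump or defect at a named direction (DATA), anything about `γ`, C2, S-E,
`ζ(5)`.
-/

noncomputable section

open Set MeasureTheory
open scoped Topology

namespace Summit.KontsevichZagierPeriods.Zeta5Search.Barrier.ConeGamma

/-! ### The oriented Lipschitz bound -/

/-- `max d 0 − d = max (−d) 0` (integers). -/
theorem max_zero_sub_self_int (d : ℤ) : max d 0 - d = max (-d) 0 := by
  rcases le_total 0 d with h | h
  · rw [max_eq_left h, max_eq_right (by linarith), sub_self]
  · rw [max_eq_right h, max_eq_left (by linarith), zero_sub]

/-- Bookkeeping of the oriented bound: if two increment vectors `d, e : Fin 28 → ℤ` have equal full sums and equal full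
sums of positive parts, then `Σ_{i∈F} d_i − Σ_{i∈F} e_i ≤ Σ_{k∈F} d_k⁺ + Σ_{k∉F} d_k⁻` (complement form: the left side
is `Σ_{i∉F} (e_i − d_i)`, and `Σ_{i∉F} e_i ≤ Σ_k e_k⁺ = Σ_k d_k⁺`). -/
theorem oriented_core {d e : Fin 28 → ℤ} (hall : ∑ k, e k = ∑ k, d k)
    (hpos : ∑ k, max (e k) 0 = ∑ k, max (d k) 0) :
    ∑ i ∈ FIdx, d i - ∑ i ∈ FIdx, e i ≤ ∑ k ∈ FIdx, max (d k) 0 + ∑ k ∈ FIdxᶜ, max (-d k) 0 := by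
  have hcF := Finset.sum_add_sum_compl FIdx d
  have hcE := Finset.sum_add_sum_compl FIdx e
  have hcP := Finset.sum_add_sum_compl FIdx (fun k => max (d k) 0)
  have h1 : ∑ i ∈ FIdxᶜ, e i ≤ ∑ k, max (e k) 0 :=
    (Finset.sum_le_sum fun i _ => le_max_left (e i) 0).trans
      (Finset.sum_le_sum_of_subset_of_nonneg (Finset.subset_univ _) fun k _ _ => le_max_right _ _)
  have h2 : ∑ k ∈ FIdxᶜ, max (-d k) 0 = ∑ k ∈ FIdxᶜ, max (d k) 0 - ∑ k ∈ FIdxᶜ, d k := by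
    rw [← Finset.sum_sub_distrib]
    exact Finset.sum_congr rfl fun k _ => (max_zero_sub_self_int (d k)).symm
  rw [h2]
  linarith

/-- **ORIENTED LIPSCHITZ BOUND for one torus term.** For every `σ ∈ S₇` and all `θ₁, θ₂ ∈ ℝ⁸`:
`T_σ(θ₂) − T_σ(θ₁) ≤ Σ_{k∈F} (⌊φ_kθ₂⌋ − ⌊φ_kθ₁⌋)⁺ + Σ_{k∉F} (⌊φ_kθ₁⌋ − ⌊φ_kθ₂⌋)⁺` — the term can rise only through
`F`-floors going up or `F^c`-floors going down (its coefficient on `⌊φ_k⌋` is in `{0,1}` for `k ∈ F`, in `{−1,0}` for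
`k ∉ F`). -/
theorem torusTerm_sub_le_oriented (θ₁ θ₂ : Fin 8 → ℝ) (σ : Equiv.Perm (Fin 7)) :
    torusTerm θ₂ σ - torusTerm θ₁ σ ≤
      ∑ k ∈ FIdx, max (⌊phiForm θ₂ k⌋ - ⌊phiForm θ₁ k⌋) 0 +
        ∑ k ∈ FIdxᶜ, max (⌊phiForm θ₁ k⌋ - ⌊phiForm θ₂ k⌋) 0 := by
  have hdiff : torusTerm θ₂ σ - torusTerm θ₁ σ =
      ∑ i ∈ FIdx, (⌊phiForm θ₂ i⌋ - ⌊phiForm θ₁ i⌋) -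
        ∑ i ∈ FIdx, (⌊phiForm (permS σ θ₂) i⌋ - ⌊phiForm (permS σ θ₁) i⌋) := by
    simp only [torusTerm, Finset.sum_sub_distrib]; ring
  have hall : ∑ k, (⌊phiForm (permS σ θ₂) k⌋ - ⌊phiForm (permS σ θ₁) k⌋) =
      ∑ k, (⌊phiForm θ₂ k⌋ - ⌊phiForm θ₁ k⌋) := by
    have h := sum_univ_phiForm_permS₂ (fun p q => (((⌊q⌋ - ⌊p⌋ : ℤ)) : ℝ)) σ θ₁ θ₂
    exact_mod_cast h
  have hpos : ∑ k, max (⌊phiForm (permS σ θ₂) k⌋ - ⌊phiForm (permS σ θ₁) k⌋) 0 =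
      ∑ k, max (⌊phiForm θ₂ k⌋ - ⌊phiForm θ₁ k⌋) 0 := by
    have h := sum_univ_phiForm_permS₂ (fun p q => ((max (⌊q⌋ - ⌊p⌋) 0 : ℤ) : ℝ)) σ θ₁ θ₂
    exact_mod_cast h
  have key := oriented_core (d := fun k => ⌊phiForm θ₂ k⌋ - ⌊phiForm θ₁ k⌋)
    (e := fun k => ⌊phiForm (permS σ θ₂) k⌋ - ⌊phiForm (permS σ θ₁) k⌋) hall hpos
  simp only [neg_sub] at key
  rw [hdiff]
  exact key

/-- **ORIENTED LIPSCHITZ BOUND for the saving, upper half.** For all `θ₁, θ₂ ∈ ℝ⁸`: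
`𝒩(θ₂) − 𝒩(θ₁) ≤ Σ_{k∈F} (⌊φ_kθ₂⌋ − ⌊φ_kθ₁⌋)⁺ + Σ_{k∉F} (⌊φ_kθ₁⌋ − ⌊φ_kθ₂⌋)⁺` — only FAVOURABLE unit moves (an
`F`-floor up, an `F^c`-floor down) can raise `𝒩`, each by at most one. -/
theorem torusN_sub_le_oriented (θ₁ θ₂ : Fin 8 → ℝ) :
    torusN θ₂ - torusN θ₁ ≤
      ∑ k ∈ FIdx, max (⌊phiForm θ₂ k⌋ - ⌊phiForm θ₁ k⌋) 0 +
        ∑ k ∈ FIdxᶜ, max (⌊phiForm θ₁ k⌋ - ⌊phiForm θ₂ k⌋) 0 := by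
  obtain ⟨σ, -, hσ⟩ := Finset.exists_mem_eq_sup' Finset.univ_nonempty (torusTerm θ₂)
  have h1 : torusN θ₂ = torusTerm θ₂ σ := by unfold torusN; rw [hσ]
  have h2 : torusTerm θ₁ σ ≤ torusN θ₁ := Finset.le_sup' (torusTerm θ₁) (Finset.mem_univ σ)
  have h3 := torusTerm_sub_le_oriented θ₁ θ₂ σ
  linarith

/-- **ORIENTED LIPSCHITZ BOUND for the saving, lower half** (the upper half with `θ₁ ↔ θ₂`):
`−(Σ_{k∈F} (⌊φ_kθ₁⌋ − ⌊φ_kθ₂⌋)⁺ + Σ_{k∉F} (⌊φ_kθ₂⌋ − ⌊φ_kθ₁⌋)⁺) ≤ 𝒩(θ₂) − 𝒩(θ₁)` — only UNFAVOURABLE unit moves can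
lower `𝒩`, each by at most one. -/
theorem oriented_le_torusN_sub (θ₁ θ₂ : Fin 8 → ℝ) :
    -(∑ k ∈ FIdx, max (⌊phiForm θ₁ k⌋ - ⌊phiForm θ₂ k⌋) 0 +
        ∑ k ∈ FIdxᶜ, max (⌊phiForm θ₂ k⌋ - ⌊phiForm θ₁ k⌋) 0) ≤ torusN θ₂ - torusN θ₁ := by
  have h := torusN_sub_le_oriented θ₂ θ₁
  linarith

/-- **𝒩 IS MONOTONE IN EVERY WALL.** If every `F`-floor weakly increases from `θ₁` to `θ₂` and every `F^c`-floor weakly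
decreases, then `𝒩(θ₁) ≤ 𝒩(θ₂)`: `F`-walls push the saving up, `F^c`-walls push it down. -/
theorem torusN_mono_of_floors {θ₁ θ₂ : Fin 8 → ℝ} (hF : ∀ k ∈ FIdx, ⌊phiForm θ₁ k⌋ ≤ ⌊phiForm θ₂ k⌋)
    (hFc : ∀ k ∉ FIdx, ⌊phiForm θ₂ k⌋ ≤ ⌊phiForm θ₁ k⌋) : torusN θ₁ ≤ torusN θ₂ := by
  have h := oriented_le_torusN_sub θ₁ θ₂
  have h1 : ∑ k ∈ FIdx, max (⌊phiForm θ₁ k⌋ - ⌊phiForm θ₂ k⌋) 0 = 0 :=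
    Finset.sum_eq_zero fun k hk => by rw [max_eq_right]; linarith [hF k hk]
  have h2 : ∑ k ∈ FIdxᶜ, max (⌊phiForm θ₂ k⌋ - ⌊phiForm θ₁ k⌋) 0 = 0 :=
    Finset.sum_eq_zero fun k hk => by rw [max_eq_right]; linarith [hFc k (Finset.mem_compl.mp hk)]
  rw [h1, h2] at h
  linarith

/-- **ONE FLOOR STEP.** If exactly one floor `⌊φ_{k₀}⌋` goes up by one from `θ₁` to `θ₂` and the other 27 are equal,
then `𝒩` moves by a step in `{0, +1}` if `k₀ ∈ F` and in `{−1, 0}` if `k₀ ∉ F`. -/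
theorem torusN_floor_step {θ₁ θ₂ : Fin 8 → ℝ} {k₀ : Fin 28}
    (hk₀ : ⌊phiForm θ₂ k₀⌋ = ⌊phiForm θ₁ k₀⌋ + 1) (hother : ∀ k, k ≠ k₀ → ⌊phiForm θ₂ k⌋ = ⌊phiForm θ₁ k⌋) :
    (k₀ ∈ FIdx → torusN θ₁ ≤ torusN θ₂ ∧ torusN θ₂ ≤ torusN θ₁ + 1) ∧
    (k₀ ∉ FIdx → torusN θ₂ ≤ torusN θ₁ ∧ torusN θ₁ ≤ torusN θ₂ + 1) := by
  have hU := torusN_sub_le_oriented θ₁ θ₂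
  have hL := oriented_le_torusN_sub θ₁ θ₂
  have e1 : ∀ k, max (⌊phiForm θ₂ k⌋ - ⌊phiForm θ₁ k⌋) 0 = if k = k₀ then 1 else 0 := by
    intro k
    by_cases h : k = k₀
    · rw [if_pos h, h, hk₀]; simp
    · rw [if_neg h, hother k h]; simp
  have e2 : ∀ k, max (⌊phiForm θ₁ k⌋ - ⌊phiForm θ₂ k⌋) 0 = 0 := by
    intro k
    by_cases h : k = k₀
    · rw [h, hk₀]; simp
    · rw [hother k h]; simp
  simp only [e1, e2, Finset.sum_const_zero, add_zero, zero_add, Finset.sum_ite_eq'] at hU hL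
  constructor
  · intro hk
    have hk' : k₀ ∉ FIdxᶜ := fun h => (Finset.mem_compl.mp h) hk
    rw [if_pos hk] at hU
    rw [if_neg hk'] at hL
    constructor <;> linarith
  · intro hk
    rw [if_neg hk] at hU
    rw [if_pos (Finset.mem_compl.mpr hk)] at hL
    constructor <;> linarith

/-! ### Along an orbit: the floors near a breakpoint and the oriented jump bound -/

/-- **The floors near a breakpoint.** At `b ∈ bkpts a T`, for a displacement `Δ` whose 28 forms are `< 1` and
`< wallDist a T` in size: a MEMBER form `k` (`b·h_k(a) = z ∈ ℤ`) has `⌊φ_k(θ_b + Δ)⌋ = z` if `φ_k(Δ) > 0` and `= z − 1`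
if `φ_k(Δ) < 0`; a non-member floor is frozen, `⌊φ_k(θ_b + Δ)⌋ = ⌊b·h_k(a)⌋` (`θ_b = b·s(a)`). -/
theorem floor_phiForm_bkpt_add {a : Dir} {T b : ℝ} (hb : b ∈ bkpts a T) {Δ : Fin 8 → ℝ}
    (hΔ1 : ∀ k, |phiForm Δ k| < 1) (hΔ2 : ∀ k, |phiForm Δ k| < wallDist a T) (k : Fin 28) :
    (∀ z : ℤ, b * h28 a k = z → 0 < phiForm Δ k → ⌊phiForm (b • sParam a + Δ) k⌋ = z) ∧
    (∀ z : ℤ, b * h28 a k = z → phiForm Δ k < 0 → ⌊phiForm (b • sParam a + Δ) k⌋ = z - 1) ∧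
    ((∀ z : ℤ, b * h28 a k ≠ z) → ⌊phiForm (b • sParam a + Δ) k⌋ = ⌊b * h28 a k⌋) := by
  rw [phiForm_line]
  refine ⟨fun z hz hp => ?_, fun z hz hn => ?_, fun hnon => ?_⟩
  · rw [hz, Int.floor_intCast_add, Int.floor_eq_zero_iff.mpr ⟨hp.le, (abs_lt.mp (hΔ1 k)).2⟩, add_zero]
  · rw [hz, Int.floor_intCast_add]
    have h1 : ⌊phiForm Δ k⌋ = -1 := by
      rw [Int.floor_eq_iff]; push_cast; constructor <;> linarith [(abs_lt.mp (hΔ1 k)).1]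
    rw [h1]; ring
  · simpa only [one_mul] using floor_add_mul_eq_of_nonmember (x := b * h28 a k) (y := phiForm Δ k)
      (fun z => (hΔ2 k).trans_le (wallDist_le hb k hnon z)) zero_le_one le_rfl

/-- The line step `±t·s(a)` as a displacement: forms `±t·h_k(a)`, of size `t·h_k ≤ t·x_max`. -/
theorem phiForm_line_step_small {a : Dir} (hpos : ∀ k, 0 < h28 a k) {t : ℝ} (ht : 0 < t) {c : ℝ}
    (htc : t * xMax a < c) (k : Fin 28) :
    phiForm (t • sParam a) k = t * h28 a k ∧ phiForm ((-t) • sParam a) k = -(t * h28 a k) ∧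
      0 < t * h28 a k ∧ |phiForm (t • sParam a) k| < c ∧ |phiForm ((-t) • sParam a) k| < c := by
  have e1 : phiForm (t • sParam a) k = t * h28 a k := phiForm_smul_sParam t a k
  have e2 : phiForm ((-t) • sParam a) k = -(t * h28 a k) := by rw [phiForm_smul_sParam]; ring
  have hp : 0 < t * h28 a k := mul_pos ht (hpos k)
  have hle : t * h28 a k < c := (mul_le_mul_of_nonneg_left (le_xMax a k) ht.le).trans_lt htc
  refine ⟨e1, e2, hp, ?_, ?_⟩
  · rw [e1, abs_of_pos hp]; exact hle
  · rw [e2, abs_neg, abs_of_pos hp]; exact hle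

/-- **ORIENTED JUMP BOUND across a breakpoint.** Let all 28 forms of `a` be positive, `b ∈ bkpts a T`, and `t > 0` a
line step below the walls (`t·x_max < 1`, `t·x_max < wallDist a T`), so that `𝒩(θ_b + t·s(a))` and `𝒩(θ_b − t·s(a))`
are the values of `N_a` just right and just left of `b`. If `S_F ⊇ {members k ∈ F}` and `S_c ⊇ {members k ∉ F}`
(members: `b·h_k(a) ∈ ℤ`), then `−#S_c ≤ 𝒩(θ_b + t·s) − 𝒩(θ_b − t·s) ≤ #S_F`: across `b` every member floor goes up
by one and nothing else moves, so the jump is at most the number of `F`-walls met at `b` and at least minus the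
number of `F^c`-walls met there. -/
theorem torusN_jump_oriented {a : Dir} (hpos : ∀ k, 0 < h28 a k) {T b : ℝ} (hb : b ∈ bkpts a T)
    {t : ℝ} (ht : 0 < t) (ht1 : t * xMax a < 1) (ht2 : t * xMax a < wallDist a T)
    {SF Sc : Finset (Fin 28)} (hSF : ∀ k, (∃ z : ℤ, b * h28 a k = z) → k ∈ FIdx → k ∈ SF)
    (hSc : ∀ k, (∃ z : ℤ, b * h28 a k = z) → k ∉ FIdx → k ∈ Sc) :
    -(Sc.card : ℤ) ≤ torusN (b • sParam a + t • sParam a) - torusN (b • sParam a - t • sParam a) ∧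
    torusN (b • sParam a + t • sParam a) - torusN (b • sParam a - t • sParam a) ≤ SF.card := by
  have hneg : b • sParam a - t • sParam a = b • sParam a + (-t) • sParam a := by
    rw [neg_smul, sub_eq_add_neg]
  rw [hneg]
  have hs1 := fun k => phiForm_line_step_small hpos ht ht1 k
  have hs2 := fun k => phiForm_line_step_small hpos ht ht2 k
  -- the increments: `1` at members, `0` at non-members
  have hd : ∀ k, ((∃ z : ℤ, b * h28 a k = z) ∧
      ⌊phiForm (b • sParam a + t • sParam a) k⌋ - ⌊phiForm (b • sParam a + (-t) • sParam a) k⌋ = 1) ∨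
      ((∀ z : ℤ, b * h28 a k ≠ z) ∧
      ⌊phiForm (b • sParam a + t • sParam a) k⌋ - ⌊phiForm (b • sParam a + (-t) • sParam a) k⌋ = 0) := by
    intro k
    obtain ⟨e1, e2, hp, -, -⟩ := hs1 k
    have fP := floor_phiForm_bkpt_add hb (Δ := t • sParam a) (fun k => (hs1 k).2.2.2.1)
      (fun k => (hs2 k).2.2.2.1) k
    have fM := floor_phiForm_bkpt_add hb (Δ := (-t) • sParam a) (fun k => (hs1 k).2.2.2.2)
      (fun k => (hs2 k).2.2.2.2) k
    by_cases hm : ∃ z : ℤ, b * h28 a k = z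
    · obtain ⟨z, hz⟩ := hm
      left
      refine ⟨⟨z, hz⟩, ?_⟩
      rw [fP.1 z hz (by rw [e1]; exact hp), fM.2.1 z hz (by rw [e2]; linarith)]
      ring
    · push Not at hm
      right
      exact ⟨hm, by rw [fP.2.2 hm, fM.2.2 hm, sub_self]⟩
  have hU := torusN_sub_le_oriented (b • sParam a + (-t) • sParam a) (b • sParam a + t • sParam a)
  have hL := oriented_le_torusN_sub (b • sParam a + (-t) • sParam a) (b • sParam a + t • sParam a)
  -- pointwise evaluation of the four summands
  have p1 : ∀ k, max (⌊phiForm (b • sParam a + t • sParam a) k⌋ -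
      ⌊phiForm (b • sParam a + (-t) • sParam a) k⌋) 0 ≤ 1 ∧
      (max (⌊phiForm (b • sParam a + t • sParam a) k⌋ -
        ⌊phiForm (b • sParam a + (-t) • sParam a) k⌋) 0 = 1 → ∃ z : ℤ, b * h28 a k = z) ∧
      max (⌊phiForm (b • sParam a + (-t) • sParam a) k⌋ -
        ⌊phiForm (b • sParam a + t • sParam a) k⌋) 0 = 0 := by
    intro k
    rcases hd k with ⟨hm, h⟩ | ⟨hm, h⟩
    · refine ⟨by rw [h]; simp, fun _ => hm, ?_⟩
      rw [show ⌊phiForm (b • sParam a + (-t) • sParam a) k⌋ - ⌊phiForm (b • sParam a + t • sParam a) k⌋ = -1 by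
        linarith]
      simp
    · refine ⟨by rw [h]; simp, fun h1 => ?_, ?_⟩
      · rw [h] at h1; simp at h1
      · rw [show ⌊phiForm (b • sParam a + (-t) • sParam a) k⌋ - ⌊phiForm (b • sParam a + t • sParam a) k⌋ = 0 by
          linarith]
        simp
  -- upper bound: the favourable count is the number of members in `F`
  have hup : ∑ k ∈ FIdx, max (⌊phiForm (b • sParam a + t • sParam a) k⌋ -
      ⌊phiForm (b • sParam a + (-t) • sParam a) k⌋) 0 ≤ SF.card := by
    calc ∑ k ∈ FIdx, max (⌊phiForm (b • sParam a + t • sParam a) k⌋ -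
          ⌊phiForm (b • sParam a + (-t) • sParam a) k⌋) 0
        ≤ ∑ k ∈ FIdx, (if k ∈ SF then (1 : ℤ) else 0) := by
          refine Finset.sum_le_sum fun k hk => ?_
          split_ifs with hkS
          · exact (p1 k).1
          · refine le_of_eq ?_
            by_contra hne
            have hle := (p1 k).1
            have hnn : (0 : ℤ) ≤ max (⌊phiForm (b • sParam a + t • sParam a) k⌋ -
              ⌊phiForm (b • sParam a + (-t) • sParam a) k⌋) 0 := le_max_right _ _
            have h1 : max (⌊phiForm (b • sParam a + t • sParam a) k⌋ -
              ⌊phiForm (b • sParam a + (-t) • sParam a) k⌋) 0 = 1 := by omega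
            exact hkS (hSF k ((p1 k).2.1 h1) hk)
      _ = ((FIdx.filter fun k => k ∈ SF).card : ℤ) := by rw [Finset.sum_boole]
      _ ≤ SF.card := by
          exact_mod_cast Finset.card_le_card fun x hx => (Finset.mem_filter.mp hx).2
  have hzero1 : ∑ k ∈ FIdxᶜ, max (⌊phiForm (b • sParam a + (-t) • sParam a) k⌋ -
      ⌊phiForm (b • sParam a + t • sParam a) k⌋) 0 = 0 :=
    Finset.sum_eq_zero fun k _ => (p1 k).2.2
  have hzero2 : ∑ k ∈ FIdx, max (⌊phiForm (b • sParam a + (-t) • sParam a) k⌋ -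
      ⌊phiForm (b • sParam a + t • sParam a) k⌋) 0 = 0 :=
    Finset.sum_eq_zero fun k _ => (p1 k).2.2
  -- lower bound: the unfavourable count is the number of members outside `F`
  have hlow : ∑ k ∈ FIdxᶜ, max (⌊phiForm (b • sParam a + t • sParam a) k⌋ -
      ⌊phiForm (b • sParam a + (-t) • sParam a) k⌋) 0 ≤ Sc.card := by
    calc ∑ k ∈ FIdxᶜ, max (⌊phiForm (b • sParam a + t • sParam a) k⌋ -
          ⌊phiForm (b • sParam a + (-t) • sParam a) k⌋) 0
        ≤ ∑ k ∈ FIdxᶜ, (if k ∈ Sc then (1 : ℤ) else 0) := by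
          refine Finset.sum_le_sum fun k hk => ?_
          split_ifs with hkS
          · exact (p1 k).1
          · refine le_of_eq ?_
            by_contra hne
            have hle := (p1 k).1
            have hnn : (0 : ℤ) ≤ max (⌊phiForm (b • sParam a + t • sParam a) k⌋ -
              ⌊phiForm (b • sParam a + (-t) • sParam a) k⌋) 0 := le_max_right _ _
            have h1 : max (⌊phiForm (b • sParam a + t • sParam a) k⌋ -
              ⌊phiForm (b • sParam a + (-t) • sParam a) k⌋) 0 = 1 := by omega
            exact hkS (hSc k ((p1 k).2.1 h1) (Finset.mem_compl.mp hk))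
      _ = ((FIdxᶜ.filter fun k => k ∈ Sc).card : ℤ) := by rw [Finset.sum_boole]
      _ ≤ Sc.card := by
          exact_mod_cast Finset.card_le_card fun x hx => (Finset.mem_filter.mp hx).2
  rw [hzero1] at hU
  rw [hzero2] at hL
  constructor <;> linarith

/-- **ORIENTED JUMP BOUND for `N_a` on the closed box**: with `a ∈ BZBox`, all forms positive, `b ∈ bkpts a T` and a
line step `t` below the walls, `−#S_c ≤ N_a(b + t) − N_a(b − t) ≤ #S_F` for any finsets `S_F ⊇ {F-members at b}`,
`S_c ⊇ {F^c-members at b}`. -/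
theorem savingN_jump_oriented {a : Dir} (ha : BZBox a) (hpos : ∀ k, 0 < h28 a k) {T b : ℝ} (hb : b ∈ bkpts a T)
    {t : ℝ} (ht : 0 < t) (ht1 : t * xMax a < 1) (ht2 : t * xMax a < wallDist a T)
    {SF Sc : Finset (Fin 28)} (hSF : ∀ k, (∃ z : ℤ, b * h28 a k = z) → k ∈ FIdx → k ∈ SF)
    (hSc : ∀ k, (∃ z : ℤ, b * h28 a k = z) → k ∉ FIdx → k ∈ Sc) :
    -(Sc.card : ℤ) ≤ savingN a (b + t) - savingN a (b - t) ∧ savingN a (b + t) - savingN a (b - t) ≤ SF.card := by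
  rw [savingN_eq_torusN_of_BZBox ha, savingN_eq_torusN_of_BZBox ha, add_smul, sub_smul]
  exact torusN_jump_oriented hpos hb ht ht1 ht2 hSF hSc

/-- **A SINGLE WALL IS AN ORIENTED STEP.** If exactly one form `h_{k₀}` is integral at the breakpoint `b`, then the
jump `N_a(b + t) − N_a(b − t)` (`t` below the walls) lies in `{0, +1}` when `k₀ ∈ F` and in `{−1, 0}` when `k₀ ∉ F`. -/
theorem savingN_jump_single_wall {a : Dir} (ha : BZBox a) (hpos : ∀ k, 0 < h28 a k) {T b : ℝ}
    (hb : b ∈ bkpts a T) {k₀ : Fin 28} (hother : ∀ k, k ≠ k₀ → ∀ z : ℤ, b * h28 a k ≠ z)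
    {t : ℝ} (ht : 0 < t) (ht1 : t * xMax a < 1) (ht2 : t * xMax a < wallDist a T) :
    (k₀ ∈ FIdx → 0 ≤ savingN a (b + t) - savingN a (b - t) ∧ savingN a (b + t) - savingN a (b - t) ≤ 1) ∧
    (k₀ ∉ FIdx → -1 ≤ savingN a (b + t) - savingN a (b - t) ∧ savingN a (b + t) - savingN a (b - t) ≤ 0) := by
  have hmem : ∀ k, (∃ z : ℤ, b * h28 a k = z) → k = k₀ := by
    intro k ⟨z, hz⟩
    by_contra h
    exact hother k h z hz
  constructor
  · intro hk
    have h := savingN_jump_oriented ha hpos hb ht ht1 ht2 (SF := {k₀}) (Sc := ∅)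
      (fun k hkm _ => by rw [hmem k hkm]; exact Finset.mem_singleton_self _)
      (fun k hkm hkF => absurd (hmem k hkm ▸ hk) hkF)
    simp only [Finset.card_singleton, Finset.card_empty, Nat.cast_one, Nat.cast_zero, neg_zero] at h
    exact h
  · intro hk
    have h := savingN_jump_oriented ha hpos hb ht ht1 ht2 (SF := ∅) (Sc := {k₀})
      (fun k hkm hkF => absurd hkF (hmem k hkm ▸ hk))
      (fun k hkm _ => by rw [hmem k hkm]; exact Finset.mem_singleton_self _)
    simp only [Finset.card_singleton, Finset.card_empty, Nat.cast_one, Nat.cast_zero] at h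
    exact ⟨by linarith [h.1], h.2⟩

end Summit.KontsevichZagierPeriods.Zeta5Search.Barrier.ConeGamma

end
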